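import Literature.Analysis.FluidPDE.AncientMildDrift
import HarnessLib

/-!
# Directionally invisible drifts in the duality-form class of bounded ancient mild solutions

Analysis/FluidPDE support file (all results proved; no definitions, no named facts): the
duality-form shadow of the parasitic drift `b(t)` of Koch–Nadirashvili–Seregin–Šverák 2009, §1
p. 3 ("Equation (1.1) has trivial non-constant solutions of the form `u(x,t) = b(t)`,
`p(x,t) = −b'(t)·x` … the notion of weak solution does allow the parasitic solutions"). It
generalises the drift lemma `IsBoundedAncientMildSolution.add_timeConst_smul_of_ae_invariant`
(`AncientMildDrift`: drifts `d(t) e` along a fixed vector `e`, with the slices `u τ` a.e.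
*invariant* under the translations along `e` wherever `d τ ≠ 0`) from "invariant slices" to
"directionally invisible drifts": a bounded time-dependent spatial constant `d : ℝ → E` (no
measurability) may be added to a bounded ancient mild solution `u` as soon as, for a.e. `τ < 0`,
the directional pairings `∫⟪u τ, D(e^{ν(t−τ)Δ}φ)[d τ]⟫` vanish for every final time `t` and every
divergence-free test field `φ` — which is all the invariance hypothesis was used for.

* `integral_inner_convect_heatTest_add_const_vec` — for `v` bounded, measurable and weakly
  divergence free and a constant vector `c`,
  `∫⟪v + c, ((v + c)·∇)e^{νσΔ}φ⟫ = ∫⟪v, (v·∇)e^{νσΔ}φ⟫ + ∫⟪v, D(e^{νσΔ}φ)[c]⟫`: of the three cross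
  terms, `∫⟪c, (v·∇)ψ⟫ = 0` by weak divergence-freeness and `∫⟪c, ∂_c ψ⟫ = 0`, and only the
  directional term survives.
* `IsBoundedAncientMildSolution.add_timeConst_of_ae_orthogonal` — the generalised drift lemma.

## References

* G. Koch, N. Nadirashvili, G. Seregin, V. Šverák, *Liouville theorems for the Navier–Stokes
  equations and applications*, Acta Math. 203 (2009) 83–105 = arXiv:0709.3599, §1 p. 3 (the
  parasitic solutions `u(x,t) = b(t)`). [KochNadirashviliSereginSverak2009]
* E. B. Fabes, B. F. Jones, N. M. Rivière, Arch. Rational Mech. Anal. 45 (1972), Thm. 2.1 (the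
  duality identity). [FabesJonesRiviere1972]
-/

noncomputable section

open MeasureTheory Set Function Filter Topology TopologicalSpace InnerProductSpace
open scoped RealInnerProductSpace NNReal ENNReal ContDiff

namespace Literature.Analysis.FluidPDE

variable {E : Type*} [NormedAddCommGroup E] [InnerProductSpace ℝ E] [FiniteDimensional ℝ E]
  [MeasurableSpace E] [BorelSpace E]

/-! ### The nonlinear integrand of a field plus a constant vector -/

section Algebra

/-- **Adding a constant `c` to a bounded weakly divergence-free field changes the nonlinear
pairing of the duality identity only by the directional term `∫⟪v, Dψ[c]⟫`.** For `v` bounded,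
measurable and weakly divergence free, a vector `c` and a test field `φ`, with `ψ = e^{νσΔ}φ`:
`∫⟪v + c, ((v + c)·∇)ψ⟫ = ∫⟪v, (v·∇)ψ⟫ + ∫⟪v, Dψ[c]⟫`. Of the three cross terms,
`∫⟪c, (v·∇)ψ⟫ = 0` by weak divergence-freeness
(`IsWeaklyDivFree.integral_inner_const_fderiv_heatTest_apply_eq_zero`) and `∫⟪c, Dψ[c]⟫ = 0`
(`integral_inner_const_fderiv_heatFlow_eq_zero`); the surviving term `∫⟪v, Dψ[c]⟫` is the one
through which the spatial constant of KNSS 2009, §1 p. 3 enters the duality identity (the case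
`c = a • e` is `integral_inner_convect_heatTest_add_const`, `KNSSThm52SliceBridge`). [folklore] -/
theorem integral_inner_convect_heatTest_add_const_vec {v : E → E}
    (hv : AEStronglyMeasurable v volume) {M : ℝ} (hM : ∀ x, ‖v x‖ ≤ M) (hdiv : IsWeaklyDivFree v)
    (c : E) {φ : E → E} (hφ : FunctionSpaces.IsTestFunctionOn (⊤ : Opens E) φ) (ν σ : ℝ) :
    ∫ x, ⟪v x + c, convect (fun y => v y + c) (heatTest ν φ σ) x⟫ =
      (∫ x, ⟪v x, convect v (heatTest ν φ σ) x⟫) + ∫ x, ⟪v x, fderiv ℝ (heatTest ν φ σ) x c⟫ := by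
  -- adapted from `integral_inner_convect_heatTest_add_const_eq` (`AncientMildDrift`)
  have hφ1 : ContDiff ℝ 1 φ := hφ.contDiff.of_le (by exact_mod_cast le_top)
  set ψ := heatTest ν φ σ with hψ_def
  have hDc_c : Continuous fun z => fderiv ℝ φ z c :=
    (hφ1.continuous_fderiv one_ne_zero).clm_apply continuous_const
  -- `Dψ[c] = e^{νσΔ}(Dφ[c])` is integrable
  have hDc_i : Integrable fun x => fderiv ℝ ψ x c := by
    have : Integrable (heatFlow (fun z => fderiv ℝ φ z c) (ν * σ)) :=
      integrable_heatFlow (hDc_c.integrable_of_hasCompactSupport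
        (hφ.hasCompactSupport.fderiv_apply (𝕜 := ℝ) c)) _
    exact this.congr (Eventually.of_forall fun x =>
      (fderiv_heatFlow_apply hφ1 hφ.hasCompactSupport _ x c).symm)
  have iA : Integrable fun x => ⟪v x, fderiv ℝ ψ x (v x)⟫ := by
    simpa only [convect_apply] using integrable_inner_convect_heatTest hv hM hφ ν σ
  have iB : Integrable fun x => ⟪v x, fderiv ℝ ψ x c⟫ :=
    integrable_inner_of_aestronglyMeasurable_of_norm_le hv hM hDc_i
  have iC : Integrable fun x => ⟪c, fderiv ℝ ψ x (v x)⟫ := by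
    simpa only [convect_apply] using (integrable_convect_heatTest hv hM hφ ν σ).const_inner c
  have iD : Integrable fun x => ⟪c, fderiv ℝ ψ x c⟫ := hDc_i.const_inner c
  have eC : ∫ x, ⟪c, fderiv ℝ ψ x (v x)⟫ = 0 :=
    hdiv.integral_inner_const_fderiv_heatTest_apply_eq_zero hv hM c hφ ν σ
  have eD : ∫ x, ⟪c, fderiv ℝ ψ x c⟫ = 0 := by
    rw [hψ_def, show heatTest ν φ σ = heatFlow φ (ν * σ) from rfl]
    exact integral_inner_const_fderiv_heatFlow_eq_zero hφ1 hφ.hasCompactSupport (ν * σ) c c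
  have iAC : Integrable fun x => ⟪v x, fderiv ℝ ψ x (v x)⟫ + ⟪c, fderiv ℝ ψ x (v x)⟫ := iA.add iC
  have iBD : Integrable fun x => ⟪v x, fderiv ℝ ψ x c⟫ + ⟪c, fderiv ℝ ψ x c⟫ := iB.add iD
  calc ∫ x, ⟪v x + c, convect (fun y => v y + c) ψ x⟫
      = ∫ x, (⟪v x, fderiv ℝ ψ x (v x)⟫ + ⟪c, fderiv ℝ ψ x (v x)⟫) +
          (⟪v x, fderiv ℝ ψ x c⟫ + ⟪c, fderiv ℝ ψ x c⟫) :=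
        integral_congr_ae (Eventually.of_forall fun x => by
          simp only [convect_apply, map_add, inner_add_left, inner_add_right])
    _ = ((∫ x, ⟪v x, fderiv ℝ ψ x (v x)⟫) + ∫ x, ⟪c, fderiv ℝ ψ x (v x)⟫) +
          ((∫ x, ⟪v x, fderiv ℝ ψ x c⟫) + ∫ x, ⟪c, fderiv ℝ ψ x c⟫) := by
        rw [integral_add iAC iBD, integral_add iA iC, integral_add iB iD]
    _ = (∫ x, ⟪v x, fderiv ℝ ψ x (v x)⟫) + ∫ x, ⟪v x, fderiv ℝ ψ x c⟫ := by
        rw [eC, eD, add_zero, add_zero]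
    _ = (∫ x, ⟪v x, convect v ψ x⟫) + ∫ x, ⟪v x, fderiv ℝ ψ x c⟫ := by
        simp only [convect_apply]

end Algebra

/-! ### The generalised drift lemma -/

section Drift

/-- **The generalised drift lemma: a bounded time-dependent spatial constant which is
a.e.-in-time invisible to the directional pairings can be added to a bounded ancient mild
solution.** Let `u` be a bounded ancient mild solution with measurable slices and `d : ℝ → E`
*any* function bounded on `t < 0` (no measurability is assumed). Suppose that for a.e. `τ < 0`
the directional pairings `∫⟪u τ, D(e^{ν(t−τ)Δ}φ)[d τ]⟫` vanish for every `t` and every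
divergence-free test field `φ`. Then `(t, x) ↦ u t x + d t` is again a bounded ancient mild
solution: its slices are weakly divergence free (constant fields are divergence free) and bounded
by `M + D`, the two endpoint pairings of the duality identity do not see the spatially constant
drift (divergence-free tests and their caloric extensions have zero mean,
`integral_inner_const_eq_zero_of_isDivFree`, `integral_inner_const_heatFlow`), and its nonlinear
time integrand coincides with that of `u` at a.e. `τ ∈ (s, t)`
(`integral_inner_convect_heatTest_add_const_vec` and the hypothesis), so that both time integrals
— honest or junk — agree. The special case `d t = d₀(t) • e` with `e`-invariant slices is
`IsBoundedAncientMildSolution.add_timeConst_smul_of_ae_invariant` (`AncientMildDrift`); this is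
the duality-form shadow of the Galilean ambiguity `b(t)` of KNSS 2009, §1 p. 3.
[cite: KochNadirashviliSereginSverak2009, §1 p. 3 (parasitic solutions u(x,t) = b(t))] -/
theorem IsBoundedAncientMildSolution.add_timeConst_of_ae_orthogonal {ν : ℝ} {u : ℝ → E → E}
    (hu : IsBoundedAncientMildSolution ν u) (hmeas : ∀ t < 0, AEStronglyMeasurable (u t) volume)
    (d : ℝ → E) (hd : ∃ D : ℝ, ∀ t < 0, ‖d t‖ ≤ D)
    (horth : ∀ᵐ τ ∂((volume : Measure ℝ).restrict (Iio 0)), ∀ t : ℝ, ∀ φ : E → E,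
      FunctionSpaces.IsTestFunctionOn (⊤ : Opens E) φ → VectorCalculus.IsDivFree φ →
        ∫ x, ⟪u τ x, fderiv ℝ (heatTest ν φ (t - τ)) x (d τ)⟫ = 0) :
    IsBoundedAncientMildSolution ν (fun t x => u t x + d t) := by
  -- adapted from `IsBoundedAncientMildSolution.add_timeConst_smul_of_ae_invariant` (`AncientMildDrift`)
  obtain ⟨M, hM'⟩ := hu.2
  have hM : ∀ t < 0, ∀ x, ‖u t x‖ ≤ M := fun t ht x => hM' t ht x
  obtain ⟨D, hD⟩ := hd
  refine ⟨⟨fun t ht θ hθ => ?_, fun s t hst ht φ hφ hdiv => ?_⟩, ⟨M + D, fun t ht x => ?_⟩⟩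
  · -- weakly divergence free slices
    haveI : CompleteSpace E := FiniteDimensional.complete ℝ E
    have hθ1 : ContDiff ℝ 1 θ := hθ.contDiff.of_le (by exact_mod_cast le_top)
    have hgc : Continuous (gradient θ) :=
      (InnerProductSpace.toDual ℝ E).symm.continuous.comp (hθ1.continuous_fderiv one_ne_zero)
    have hgs : HasCompactSupport (gradient θ) :=
      (hθ.hasCompactSupport.fderiv ℝ).comp_left
        (g := fun L => (InnerProductSpace.toDual ℝ E).symm L) (map_zero _)
    have hgi : Integrable (gradient θ) := hgc.integrable_of_hasCompactSupport hgs
    have i1 : Integrable fun x => ⟪u t x, gradient θ x⟫ :=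
      integrable_inner_of_aestronglyMeasurable_of_norm_le (hmeas t ht) (hM t ht) hgi
    have i2 : Integrable fun x => ⟪d t, gradient θ x⟫ := hgi.const_inner _
    calc ∫ x, ⟪u t x + d t, gradient θ x⟫
        = (∫ x, ⟪u t x, gradient θ x⟫) + ∫ x, ⟪d t, gradient θ x⟫ := by
          rw [← integral_add i1 i2]
          exact integral_congr_ae (Eventually.of_forall fun x => by simp only [inner_add_left])
      _ = 0 := by
          rw [hu.1.1 t ht θ hθ, (VectorCalculus.IsDivFree.isWeaklyDivFree_holds
            (u := fun _ : E => d t) (fun x => by simp [VectorCalculus.divergence])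
            contDiff_const) θ hθ, add_zero]
  · -- the two-time identity
    have hs : s < 0 := hst.trans ht
    have key := hu.1.2 s t hst ht φ hφ hdiv
    have hφ1 : ContDiff ℝ 1 φ := hφ.contDiff.of_le (by exact_mod_cast le_top)
    have hφi : Integrable φ :=
      hφ.contDiff.continuous.integrable_of_hasCompactSupport hφ.hasCompactSupport
    have e1 : ∫ x, ⟪u t x + d t, φ x⟫ = ∫ x, ⟪u t x, φ x⟫ := by
      have i1 := integrable_inner_of_aestronglyMeasurable_of_norm_le (hmeas t ht) (hM t ht) hφi
      have i2 : Integrable fun x => ⟪d t, φ x⟫ := hφi.const_inner _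
      rw [show (fun x => ⟪u t x + d t, φ x⟫) = fun x => ⟪u t x, φ x⟫ + ⟪d t, φ x⟫ from
        funext fun x => inner_add_left _ _ _, integral_add i1 i2,
        integral_inner_const_eq_zero_of_isDivFree (d t) hφ1 hφ.hasCompactSupport hdiv, add_zero]
    have e2 : ∫ x, ⟪u s x + d s, heatTest ν φ (t - s) x⟫ =
        ∫ x, ⟪u s x, heatTest ν φ (t - s) x⟫ := by
      have hψi : Integrable (heatTest ν φ (t - s)) := integrable_heatFlow hφi _
      have i1 := integrable_inner_of_aestronglyMeasurable_of_norm_le (hmeas s hs) (hM s hs) hψi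
      have i2 : Integrable fun x => ⟪d s, heatTest ν φ (t - s) x⟫ := hψi.const_inner _
      have h0 : ∫ x, ⟪d s, heatTest ν φ (t - s) x⟫ = 0 := by
        rw [show heatTest ν φ (t - s) = heatFlow φ (ν * (t - s)) from rfl,
          integral_inner_const_heatFlow hφi,
          integral_inner_const_eq_zero_of_isDivFree (d s) hφ1 hφ.hasCompactSupport hdiv]
      rw [show (fun x => ⟪u s x + d s, heatTest ν φ (t - s) x⟫) =
          fun x => ⟪u s x, heatTest ν φ (t - s) x⟫ + ⟪d s, heatTest ν φ (t - s) x⟫ from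
        funext fun x => inner_add_left _ _ _, integral_add i1 i2, h0, add_zero]
    -- the nonlinear time integrands agree at a.e. `τ ∈ (s, t)`
    have e3 : (∫ τ in s..t, ∫ x, ⟪u τ x + d τ,
        convect (fun y => u τ y + d τ) (heatTest ν φ (t - τ)) x⟫) =
        ∫ τ in s..t, ∫ x, ⟪u τ x, convect (u τ) (heatTest ν φ (t - τ)) x⟫ := by
      refine intervalIntegral.integral_congr_ae ?_
      have horth' := (ae_restrict_iff' (measurableSet_Iio : MeasurableSet (Iio (0 : ℝ)))).1 horth
      filter_upwards [horth'] with τ hτ hτmem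
      rw [uIoc_of_le hst.le] at hτmem
      have hτ0 : τ < 0 := hτmem.2.trans_lt ht
      have h1 := integral_inner_convect_heatTest_add_const_vec (hmeas τ hτ0) (hM τ hτ0)
        (hu.1.1 τ hτ0) (d τ) hφ ν (t - τ)
      rw [hτ hτ0 t φ hφ hdiv, add_zero] at h1
      exact h1
    show ∫ x, ⟪u t x + d t, φ x⟫ = (∫ x, ⟪u s x + d s, heatTest ν φ (t - s) x⟫) +
        (∫ τ in s..t, ∫ x, ⟪u τ x + d τ,
          convect (fun y => u τ y + d τ) (heatTest ν φ (t - τ)) x⟫) +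
        ∫ τ in s..t, ∫ x, ⟪(0 : ℝ → E → E) τ x, heatTest ν φ (t - τ) x⟫
    rw [e1, e2, e3]
    exact key
  · -- the bound
    calc ‖u t x + d t‖ ≤ ‖u t x‖ + ‖d t‖ := norm_add_le _ _
      _ ≤ M + D := add_le_add (hM t ht x) (hD t ht)

end Drift

end Literature.Analysis.FluidPDE
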